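import Literature.NumberTheory.EllipticCurves.Sprung2017.ChromaticLimit
import Literature.NumberTheory.EllipticCurves.Sprung2017.MAdicLimitProofs
import Literature.NumberTheory.EllipticCurves.Sprung2017.SharpFlatPAdicLFunctionProofs
import HarnessLib

/-!
# The chromatic (♯/♭) limit is CONTINUOUS in the sequence: if `Θ_n, Θ_{n+1} ∈ p^k ℤ_p[T]` then the
# coefficients of `C♭` (resp. `C♯`) are divisible by `p^{min(k, ⌊n/2⌋ − i)}` (Sprung 2017 Cor. 4.4 /
# Sprung 2012 Prop. 5.7 «⋂ M_n = 0», quantitative form) — proofs only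

`Proofs` file (theorems only: **no definition, no named fact**; axioms standard), topic
`Literature/NumberTheory/EllipticCurves`, cluster `Sprung2017`; sequel of `ChromaticLimit.lean`
(`IsChromaticLimit`, uniqueness `IsChromaticLimit.unique`) and `MAdicLimitProofs.lean` (coefficient
estimates `MAdic.dvd_coeff_mul_of_dvd_coeff`). Source of the argument: the uniqueness proof of
F. Sprung, *The Iwasawa Main Conjecture for elliptic curves at odd supersingular primes* / ANT 11 (2017)
Thm. 1.12 and Cor. 4.4 [Sprung2017], and F. E. I. Sprung, J. Number Theory 132 (2012) Prop. 5.7,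
Lemma 5.8 ("`⋂_n M_n = 0`") [Sprung2012]: the Wronskian `u_{n+1} v_n − v_{n+1} u_n = ω_n/T` and
`u_n, v_n ∈ (p, T)^{⌊n/2⌋}`. The tree's `IsChromaticLimit.unique` runs it for ALL levels at once and an
exactly vanishing sequence; THIS FILE runs it for the TWO levels `n, n+1` with an error term `p^k`:

* §1 `C_pow_dvd_of_C_pow_dvd_coe_mul` — prime avoidance in `Λ = ℤ_p⟦T⟧`: for a MONIC `F ∈ ℤ_p[T]`,
  `p^k ∣ F·R ⇒ p^k ∣ R` (reduction to the domain `𝔽_p⟦T⟧`, where a monic polynomial is non-zero);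
* §2 `IsChromaticLimit.pow_dvd_coeff_flat` — if `(C♯, C♭)` is a chromatic limit of `Θ` (`p ∣ a_p`) and
  `p^k ∣ Θ_n`, `p^k ∣ Θ_{n+1}` in `ℤ_p[T]`, then `p^{min(k, ⌊n/2⌋ − i)} ∣ (C♭)_i` for every `i`: from the
  two congruences, `Π_n · (C♭ − T(u_{n+1}Q_n − u_n Φ_{n+1} Q_{n+1})) = p^k (u_n Θ'_{n+1} − u_{n+1} Θ'_n)`
  with `Π_n = ω_n/T` monic, so by §1 `C♭ ∈ (u_n, u_{n+1})Λ + p^k Λ`; and `IsChromaticLimit.pow_dvd_coeff_sharp`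
  (the same with `v_n, v_{n+1}`).
Consequence (used by the cell `bsd-2adic`, seat `bsd-2adic-ss-1` GEN 13, crux `SupersingularRankZeroAtTwo`
stmt-BirchSwinnertonDyer-19097, line `flat_uniform_two`, conjunct LOC♭ of `stub_allFlatData`): Sprung's
Coleman map `Col♭` is continuous for the finite topology on `Hom(E(ℚ_{p,∞}), ℤ_p)`, hence `Ker Col♭` is
CLOSED (`Summits/…/Theorems/ByReductionTypeAtTwoSupersingularFlatKernelClosed.lean`). HONEST FRAMING: pure
algebra in `ℤ_p⟦T⟧`; nothing about any curve is asserted; BSD is not proved by any of this.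

References: [Sprung2017] Thm. 1.12, §4 Cor. 4.4; [Sprung2012] Prop. 5.7, Lemma 5.8 (pp. 1494–1495);
S. Lang, *Cyclotomic Fields I–II*, Ch. 5 §1 [Lang1990].
-/

set_option autoImplicit false

noncomputable section

open Polynomial Literature.NumberTheory.EllipticCurves

namespace Literature.NumberTheory.EllipticCurves.Sprung2017

variable {p : ℕ} [hp : Fact p.Prime]

/-! ## §1 Prime avoidance in `Λ`: `p^k ∣ F·R ⇒ p^k ∣ R` for monic `F` -/

/-- `C p ∣ G` in `ℤ_p⟦T⟧` iff the reduction of `G` to `𝔽_p⟦T⟧` vanishes. [cite: Lang1990, Ch. 5 §1] -/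
theorem C_prime_dvd_iff_map_toZMod_eq_zero (G : PowerSeries ℤ_[p]) :
    PowerSeries.C (p : ℤ_[p]) ∣ G ↔ PowerSeries.map (PadicInt.toZMod (p := p)) G = 0 := by
  constructor
  · rintro ⟨H, rfl⟩
    rw [map_mul, PowerSeries.map_C]
    have : PadicInt.toZMod (p := p) (p : ℤ_[p]) = 0 := by
      rw [map_natCast, ZMod.natCast_self]
    rw [this, map_zero, zero_mul]
  · intro h
    have hc : ∀ i : ℕ, ∃ c : ℤ_[p], PowerSeries.coeff i G = (p : ℤ_[p]) * c := by
      intro i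
      have hi : PadicInt.toZMod (p := p) (PowerSeries.coeff i G) = 0 := by
        rw [← PowerSeries.coeff_map, h, map_zero]
      have hmem : PowerSeries.coeff i G ∈ RingHom.ker (PadicInt.toZMod (p := p)) := hi
      rw [PadicInt.ker_toZMod, PadicInt.maximalIdeal_eq_span_p, Ideal.mem_span_singleton] at hmem
      exact hmem
    choose c hc using hc
    refine ⟨PowerSeries.mk c, PowerSeries.ext fun i ↦ ?_⟩
    rw [PowerSeries.coeff_C_mul, PowerSeries.coeff_mk, hc i]

/-- **Prime avoidance, one `p`**: for a monic polynomial `F ∈ ℤ_p[T]` and `R ∈ Λ`, `p ∣ F·R ⇒ p ∣ R`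
(`𝔽_p⟦T⟧` is a domain and the reduction of a monic polynomial is non-zero).
[cite: Sprung2012, Lemma 5.8 (p. 1495) (the step «⋂ M_n = 0»)] -/
theorem C_dvd_of_C_dvd_coe_mul {F : ℤ_[p][X]} (hF : F.Monic) {R : PowerSeries ℤ_[p]}
    (h : PowerSeries.C (p : ℤ_[p]) ∣ (F : PowerSeries ℤ_[p]) * R) :
    PowerSeries.C (p : ℤ_[p]) ∣ R := by
  rw [C_prime_dvd_iff_map_toZMod_eq_zero] at h ⊢
  rw [map_mul, ← Polynomial.polynomial_map_coe] at h
  have hF' : ((F.map (PadicInt.toZMod (p := p)) : (ZMod p)[X]) : PowerSeries (ZMod p)) ≠ 0 := by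
    rw [Ne, Polynomial.coe_eq_zero_iff]
    exact (hF.map _).ne_zero
  exact (mul_eq_zero.mp h).resolve_left hF'

/-- **Prime avoidance, `p^k`**: for a monic `F ∈ ℤ_p[T]`, `p^k ∣ F·R ⇒ p^k ∣ R` in `Λ`.
[cite: Sprung2012, Lemma 5.8 (p. 1495) (the step «⋂ M_n = 0»)] -/
theorem C_pow_dvd_of_C_pow_dvd_coe_mul {F : ℤ_[p][X]} (hF : F.Monic) (k : ℕ) {R : PowerSeries ℤ_[p]}
    (h : PowerSeries.C ((p : ℤ_[p]) ^ k) ∣ (F : PowerSeries ℤ_[p]) * R) :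
    PowerSeries.C ((p : ℤ_[p]) ^ k) ∣ R := by
  induction k generalizing R with
  | zero => rw [pow_zero, map_one]; exact one_dvd _
  | succ k ih =>
    have e : PowerSeries.C ((p : ℤ_[p]) ^ (k + 1)) =
        PowerSeries.C (p : ℤ_[p]) * PowerSeries.C ((p : ℤ_[p]) ^ k) := by
      rw [← map_mul, ← pow_succ']
    have h1 : PowerSeries.C (p : ℤ_[p]) ∣ (F : PowerSeries ℤ_[p]) * R :=
      (Dvd.intro _ e.symm).trans h
    obtain ⟨R₁, rfl⟩ := C_dvd_of_C_dvd_coe_mul hF h1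
    obtain ⟨J, hJ⟩ := h
    have hp0 : PowerSeries.C (p : ℤ_[p]) ≠ 0 := by
      rw [Ne, PowerSeries.ext_iff, not_forall]
      refine ⟨0, ?_⟩
      rw [PowerSeries.coeff_C, if_pos rfl, map_zero]
      exact_mod_cast hp.out.ne_zero
    have hJ' : (F : PowerSeries ℤ_[p]) * R₁ = PowerSeries.C ((p : ℤ_[p]) ^ k) * J := by
      apply mul_left_cancel₀ hp0
      calc PowerSeries.C (p : ℤ_[p]) * ((F : PowerSeries ℤ_[p]) * R₁)
          = (F : PowerSeries ℤ_[p]) * (PowerSeries.C (p : ℤ_[p]) * R₁) := by ring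
        _ = PowerSeries.C ((p : ℤ_[p]) ^ (k + 1)) * J := hJ
        _ = PowerSeries.C (p : ℤ_[p]) * (PowerSeries.C ((p : ℤ_[p]) ^ k) * J) := by rw [e, mul_assoc]
    obtain ⟨R₂, rfl⟩ := ih (Dvd.intro _ hJ'.symm)
    exact ⟨R₂, by rw [e]; ring⟩

/-! ## §2 Two consecutive levels divisible by `p^k` force `p^{min(k, ⌊n/2⌋−i)} ∣ (C♭)_i`, `(C♯)_i` -/

/-- `toIwasawa` = map the coefficients and coerce. [folklore] -/
private theorem toIwasawa_apply' (q : ℤ[X]) :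
    toIwasawa p q = ((q.map (Int.castRingHom ℤ_[p]) : ℤ_[p][X]) : PowerSeries ℤ_[p]) := rfl

/-- Coefficient bound for `u_n` (resp. `v_n`): `p^{⌊n/2⌋ − j} ∣ (u_n)_j`, in `Λ`, uniformly for the
levels `n` and `n + 1`. [cite: Sprung2017, §4 Cor. 4.4 (u_n, v_n ∈ (p,T)^{⌊n/2⌋})] -/
private theorem pow_dvd_coeff_toIwasawa_sprungSeq {ap : ℤ} (hap : (p : ℤ) ∣ ap) (x₀ x₁ : ℤ[X])
    (n m j : ℕ) (hnm : n ≤ m) :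
    (p : ℤ_[p]) ^ (n / 2 - j) ∣ PowerSeries.coeff j (toIwasawa p (sprungSeq ap p x₀ x₁ m)) := by
  rw [toIwasawa_apply', Polynomial.coeff_coe]
  exact (pow_dvd_pow _ (by omega)).trans (pow_dvd_coeff_map_sprungSeq hap x₀ x₁ m j)

/-- The algebra shared by the ♭ and ♯ cases: from `Π·(C − S) = C(p^k)·J` with `Π` monic and
`p^{c−i} ∣ S_i`, conclude `p^{min(k, c−i)} ∣ C_i`. [cite: Sprung2012, Prop. 5.7 and Lemma 5.8 (pp. 1494–1495)] -/
private theorem pow_min_dvd_coeff_of_monic_mul_sub_eq {F : ℤ_[p][X]} (hF : F.Monic) {k c : ℕ}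
    {C S J : PowerSeries ℤ_[p]} (hS : ∀ i, (p : ℤ_[p]) ^ (c - i) ∣ PowerSeries.coeff i S)
    (h : (F : PowerSeries ℤ_[p]) * (C - S) = PowerSeries.C ((p : ℤ_[p]) ^ k) * J) (i : ℕ) :
    (p : ℤ_[p]) ^ min k (c - i) ∣ PowerSeries.coeff i C := by
  obtain ⟨R', hR'⟩ := C_pow_dvd_of_C_pow_dvd_coe_mul hF k (Dvd.intro _ h.symm)
  have hC : C = S + PowerSeries.C ((p : ℤ_[p]) ^ k) * R' := by rw [← hR']; ring
  rw [hC, map_add, PowerSeries.coeff_C_mul]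
  exact dvd_add ((pow_dvd_pow _ (min_le_right _ _)).trans (hS i))
    (((pow_dvd_pow _ (min_le_left _ _))).trans (dvd_mul_right _ _))

/-- **Continuity of the ♭ limit.** Let `(C♯, C♭)` be a chromatic limit of `Θ` (`p ∣ a_p`) and suppose
`p^k` divides `Θ_n` and `Θ_{n+1}` in `ℤ_p[T]`. Then `p^{min(k, ⌊n/2⌋ − i)} ∣ (C♭)_i` for every `i`.
Proof: `u_{n+1}·(level n) − u_n·(level n+1)` kills `C♯` and gives, with the Wronskian
`u_{n+1}v_n − u_n v_{n+1} = Π_n` and `ω_n = T·Π_n`, `ω_{n+1} = T·Π_n·Φ_{p^{n+1}}(1+T)`: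
`Π_n·(C♭ − T(u_{n+1}Q_n − u_nΦQ_{n+1})) = p^k(u_n Θ'_{n+1} − u_{n+1} Θ'_n)`; `Π_n` is monic, so §1 gives
`C♭ ∈ T(u_n, u_{n+1})Λ + p^kΛ`, and `u_n, u_{n+1}` have `j`-th coefficient divisible by `p^{⌊n/2⌋−j}`.
[cite: Sprung2017, Thm. 1.12 and §4 Cor. 4.4] [cite: Sprung2012, Prop. 5.7 and Lemma 5.8 (pp. 1494–1495)] -/
theorem IsChromaticLimit.pow_dvd_coeff_flat {ap : ℤ} (hap : (p : ℤ) ∣ ap) {Θ : ℕ → ℤ_[p][X]}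
    {Cs Cf : IwasawaAlgebra p} (h : IsChromaticLimit p ap Θ Cs Cf) {n k : ℕ} {A B : ℤ_[p][X]}
    (hn : Θ n = Polynomial.C ((p : ℤ_[p]) ^ k) * A) (hn1 : Θ (n + 1) = Polynomial.C ((p : ℤ_[p]) ^ k) * B)
    (i : ℕ) : (p : ℤ_[p]) ^ min k (n / 2 - i) ∣ PowerSeries.coeff i Cf := by
  -- notation
  set u : ℕ → IwasawaAlgebra p := fun m ↦ toIwasawa p (sharpPoly ap p m) with hu
  set v : ℕ → IwasawaAlgebra p := fun m ↦ toIwasawa p (flatPoly ap p m) with hv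
  set Φ' : IwasawaAlgebra p := toIwasawa p ((cyclotomic (p ^ (n + 1)) ℤ).comp (X + 1)) with hΦ'
  set Pp : ℤ[X] := ∏ j ∈ Finset.range n, (cyclotomic (p ^ (j + 1)) ℤ).comp (X + 1) with hPp
  set Pn : IwasawaAlgebra p := toIwasawa p Pp with hPn
  have hΩn : ((cyclotomicOmega p n).map (Int.castRingHom ℤ_[p]) : PowerSeries ℤ_[p]) =
      PowerSeries.X * Pn := by
    rw [← toIwasawa_apply', ← X_mul_prod_cyclotomic_comp_eq_cyclotomicOmega, map_mul, hPn, hPp]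
    congr 1
    rw [toIwasawa_apply', Polynomial.map_X, Polynomial.coe_X]
  have hΩn1 : ((cyclotomicOmega p (n + 1)).map (Int.castRingHom ℤ_[p]) : PowerSeries ℤ_[p]) =
      PowerSeries.X * Pn * Φ' := by
    rw [← toIwasawa_apply', ← X_mul_prod_cyclotomic_comp_eq_cyclotomicOmega, Finset.prod_range_succ,
      ← mul_assoc, map_mul, map_mul, hPn, hPp, hΦ']
    congr 2
    rw [toIwasawa_apply', Polynomial.map_X, Polynomial.coe_X]
  have hW : u (n + 1) * v n - v (n + 1) * u n = Pn := by
    simp only [hu, hv, hPn, hPp]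
    rw [← map_mul, ← map_mul, ← map_sub, sharpPoly_succ_mul_flatPoly_sub]
  -- the two levels
  obtain ⟨Q, hQ⟩ := h n
  obtain ⟨Q', hQ'⟩ := h (n + 1)
  rw [hΩn, hn, Polynomial.coe_mul, Polynomial.coe_C] at hQ
  rw [hΩn1, hn1, Polynomial.coe_mul, Polynomial.coe_C] at hQ'
  -- `Pn · (Cf − S) = C(p^k) · J`
  set S : IwasawaAlgebra p := PowerSeries.X * (Q * u (n + 1)) - PowerSeries.X * Φ' * (Q' * u n) with hS
  have hkey : Pn * (Cf - S) =
      PowerSeries.C ((p : ℤ_[p]) ^ k) * ((B : PowerSeries ℤ_[p]) * u n - (A : PowerSeries ℤ_[p]) * u (n + 1)) := by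
    rw [hS]
    linear_combination (u (n + 1)) * hQ - (u n) * hQ' - Cf * hW
  -- `Pn` is monic
  have hmonic : (Pp.map (Int.castRingHom ℤ_[p])).Monic := by
    refine (monic_prod_of_monic _ _ fun j _ ↦ (cyclotomic.monic _ ℤ).comp (monic_X_add_C 1) ?_).map _
    rw [natDegree_X_add_C]
    exact one_ne_zero
  have hPncoe : Pn = ((Pp.map (Int.castRingHom ℤ_[p]) : ℤ_[p][X]) : PowerSeries ℤ_[p]) := toIwasawa_apply' Pp
  rw [hPncoe] at hkey
  -- coefficient bound for `S`
  have hSc : ∀ j, (p : ℤ_[p]) ^ (n / 2 - j) ∣ PowerSeries.coeff j S := by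
    intro j
    rw [hS, map_sub]
    refine dvd_sub ?_ ?_
    · rw [← mul_assoc]
      exact MAdic.dvd_coeff_mul_of_dvd_coeff p
        (fun j ↦ pow_dvd_coeff_toIwasawa_sprungSeq hap 0 1 n (n + 1) j (Nat.le_succ n)) _ j
    · rw [← mul_assoc]
      exact MAdic.dvd_coeff_mul_of_dvd_coeff p
        (fun j ↦ pow_dvd_coeff_toIwasawa_sprungSeq hap 0 1 n n j le_rfl) _ j
  exact pow_min_dvd_coeff_of_monic_mul_sub_eq hmonic hSc hkey i

/-- **Continuity of the ♯ limit** (same statement for `C♯`, with `v_n, v_{n+1}` in place of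
`u_n, u_{n+1}`). [cite: Sprung2017, Thm. 1.12 and §4 Cor. 4.4] [cite: Sprung2012, Prop. 5.7 and Lemma 5.8 (pp. 1494–1495)] -/
theorem IsChromaticLimit.pow_dvd_coeff_sharp {ap : ℤ} (hap : (p : ℤ) ∣ ap) {Θ : ℕ → ℤ_[p][X]}
    {Cs Cf : IwasawaAlgebra p} (h : IsChromaticLimit p ap Θ Cs Cf) {n k : ℕ} {A B : ℤ_[p][X]}
    (hn : Θ n = Polynomial.C ((p : ℤ_[p]) ^ k) * A) (hn1 : Θ (n + 1) = Polynomial.C ((p : ℤ_[p]) ^ k) * B)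
    (i : ℕ) : (p : ℤ_[p]) ^ min k (n / 2 - i) ∣ PowerSeries.coeff i Cs := by
  set u : ℕ → IwasawaAlgebra p := fun m ↦ toIwasawa p (sharpPoly ap p m) with hu
  set v : ℕ → IwasawaAlgebra p := fun m ↦ toIwasawa p (flatPoly ap p m) with hv
  set Φ' : IwasawaAlgebra p := toIwasawa p ((cyclotomic (p ^ (n + 1)) ℤ).comp (X + 1)) with hΦ'
  set Pp : ℤ[X] := ∏ j ∈ Finset.range n, (cyclotomic (p ^ (j + 1)) ℤ).comp (X + 1) with hPp
  set Pn : IwasawaAlgebra p := toIwasawa p Pp with hPn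
  have hΩn : ((cyclotomicOmega p n).map (Int.castRingHom ℤ_[p]) : PowerSeries ℤ_[p]) =
      PowerSeries.X * Pn := by
    rw [← toIwasawa_apply', ← X_mul_prod_cyclotomic_comp_eq_cyclotomicOmega, map_mul, hPn, hPp]
    congr 1
    rw [toIwasawa_apply', Polynomial.map_X, Polynomial.coe_X]
  have hΩn1 : ((cyclotomicOmega p (n + 1)).map (Int.castRingHom ℤ_[p]) : PowerSeries ℤ_[p]) =
      PowerSeries.X * Pn * Φ' := by
    rw [← toIwasawa_apply', ← X_mul_prod_cyclotomic_comp_eq_cyclotomicOmega, Finset.prod_range_succ,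
      ← mul_assoc, map_mul, map_mul, hPn, hPp, hΦ']
    congr 2
    rw [toIwasawa_apply', Polynomial.map_X, Polynomial.coe_X]
  have hW : u (n + 1) * v n - v (n + 1) * u n = Pn := by
    simp only [hu, hv, hPn, hPp]
    rw [← map_mul, ← map_mul, ← map_sub, sharpPoly_succ_mul_flatPoly_sub]
  obtain ⟨Q, hQ⟩ := h n
  obtain ⟨Q', hQ'⟩ := h (n + 1)
  rw [hΩn, hn, Polynomial.coe_mul, Polynomial.coe_C] at hQ
  rw [hΩn1, hn1, Polynomial.coe_mul, Polynomial.coe_C] at hQ'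
  set S : IwasawaAlgebra p := PowerSeries.X * Φ' * (Q' * v n) - PowerSeries.X * (Q * v (n + 1)) with hS
  have hkey : Pn * (Cs - S) =
      PowerSeries.C ((p : ℤ_[p]) ^ k) * ((A : PowerSeries ℤ_[p]) * v (n + 1) - (B : PowerSeries ℤ_[p]) * v n) := by
    rw [hS]
    linear_combination (v n) * hQ' - (v (n + 1)) * hQ - Cs * hW
  have hmonic : (Pp.map (Int.castRingHom ℤ_[p])).Monic := by
    refine (monic_prod_of_monic _ _ fun j _ ↦ (cyclotomic.monic _ ℤ).comp (monic_X_add_C 1) ?_).map _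
    rw [natDegree_X_add_C]
    exact one_ne_zero
  have hPncoe : Pn = ((Pp.map (Int.castRingHom ℤ_[p]) : ℤ_[p][X]) : PowerSeries ℤ_[p]) := toIwasawa_apply' Pp
  rw [hPncoe] at hkey
  have hSc : ∀ j, (p : ℤ_[p]) ^ (n / 2 - j) ∣ PowerSeries.coeff j S := by
    intro j
    rw [hS, map_sub]
    refine dvd_sub ?_ ?_
    · rw [← mul_assoc]
      exact MAdic.dvd_coeff_mul_of_dvd_coeff p
        (fun j ↦ pow_dvd_coeff_toIwasawa_sprungSeq hap 1 0 n n j le_rfl) _ j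
    · rw [← mul_assoc]
      exact MAdic.dvd_coeff_mul_of_dvd_coeff p
        (fun j ↦ pow_dvd_coeff_toIwasawa_sprungSeq hap 1 0 n (n + 1) j (Nat.le_succ n)) _ j
  exact pow_min_dvd_coeff_of_monic_mul_sub_eq hmonic hSc hkey i

end Literature.NumberTheory.EllipticCurves.Sprung2017

end
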